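import Summits.CriticalPhenomena.CardyFormulaZ2.Theorems.StripClusterRates.Negative.KacFromAboveFalse
import Literature.Probability.Percolation.LatticeWalksGM

/-!
# The two-cluster event is monotone in the width; the two-cluster rate `γ₂` is antitone

Support file for line `two-cluster-rate-is-stationary-gap` (crux `StripClusterRates`,
stmt-CriticalPhenomena-13878), lead c5. For the one-cluster objects of the crux, `p₁(m,n) ≤ p₁(m,n')` for `n ≤ n'`
is an inclusion of events and gives `rateOne_antitone` (`Negative.KacFromAboveFalse`). For TWO DISTINCT spanning
clusters the inclusion `E₂(m,n) ⊆ E₂(m,n+1)` is not formal — the extra row could join the two clusters — but it is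
TRUE on lattice configurations, by planarity: the LOWER of the two clusters cannot touch the top row of `[0,m]×[0,n]`
(an open path from it to the top row would meet the upper crossing: "horizontal and vertical crossings meet", after
extending both walks one column to the left, `mono_not_openConnIn_topRow`), so an open path of `[0,m]×[0,n+1]` between
the two left endpoints, stopped at its first visit to the row `n`, is impossible (`twoClusterEvent_mono_succ`, registered
sub-goal). Consequences: `pTwo_le_succ`, `pTwo_mono_right : p₂(m,n) ≤ p₂(m,n')`, and `rateTwo_antitone : γ₂(n') ≤ γ₂(n)`
for `1 ≤ n ≤ n'` — the two-cluster rate function of the crux is non-increasing in the width, like `γ₁`.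

References: Grimmett, *Percolation* (1999), §11.2 (planarity of crossings); [Aizenman1997] (monotonicity is used
implicitly in the `n`-cluster window).
-/

noncomputable section

open MeasureTheory Filter Topology
open Literature.Probability.LatticeModels Literature.Probability.Percolation

namespace Summit.CriticalPhenomena.CardyFormulaZ2.Cruxes.StripClusterRates.TwoClusterRateIsStationaryGap

open Summit.CriticalPhenomena.CardyFormulaZ2.Theorems.StripClusterRates.Negative
open SimpleGraph

/-! ## §1 The lower cluster does not touch the top row -/

/-- The point one column to the left of a left-side vertex `x` (i.e. `(-1, x₁)`) is adjacent to it. [folklore] -/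
theorem mono_adj_leftOf {x : Site 2} (hx0 : x 0 = 0) : (zdGraph 2).Adj (pt (-1) (x 1)) x :=
  adj_of_stepKind (.right (by simp [pt, hx0]) (by simp [pt]))

/-- **The lower of two distinct spanning clusters does not touch the top row.** On a lattice configuration,
let `x₁`, `x₂` be left-side vertices of `[0,m]×[0,n]` with `x₁` strictly below `x₂`, `x₂` joined inside the
rectangle to the right side, and `x₁` not joined to `x₂` inside the rectangle. Then `x₁` is joined inside the
rectangle to NO vertex of the top row: such a path, extended to start from `(-1,-1)` up the column `x = -1`, is a
bottom-top crossing of `[-1,m]×[-1,n]` and meets the upper crossing extended by the step from `(-1, (x₂)₁)`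
(`exists_mem_support_of_crossing`); the meeting vertex joins `x₁` to `x₂`. [folklore] -/
theorem mono_not_openConnIn_topRow {m n : ℕ} {ω : BondConfig (Site 2)} (hω : ω ⊆ (zdGraph 2).edgeSet)
    {x₁ x₂ y₂ t : Site 2} (hx₁ : x₁ ∈ (leftSide m n : Set (Site 2))) (hx₂ : x₂ ∈ (leftSide m n : Set (Site 2)))
    (hlt : x₁ 1 < x₂ 1) (hy₂ : y₂ ∈ (rightSide m n : Set (Site 2)))
    (h₂ : ω ∈ openConnIn (rectangle m n : Set (Site 2)) x₂ y₂)
    (h₁₂ : ω ∉ openConnIn (rectangle m n : Set (Site 2)) x₁ x₂) (ht : t 1 = (n : ℤ)) :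
    ω ∉ openConnIn (rectangle m n : Set (Site 2)) x₁ t := by
  classical
  intro hW
  obtain ⟨W, hWS, hWω⟩ := exists_walk_of_mem_openConnIn hω hW
  obtain ⟨P₂, hP₂S, hP₂ω⟩ := exists_walk_of_mem_openConnIn hω h₂
  have hx₁' := Finset.mem_filter.1 (Finset.mem_coe.1 hx₁)
  have hx₂' := Finset.mem_filter.1 (Finset.mem_coe.1 hx₂)
  have hy₂' := Finset.mem_filter.1 (Finset.mem_coe.1 hy₂)
  have hx₁R := mem_rectangle_iff.1 hx₁'.1
  have hx₂R := mem_rectangle_iff.1 hx₂'.1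
  -- the upper crossing, extended one step to the left: from `a = (-1, (x₂)₁)` to `y₂`
  set a : Site 2 := pt (-1) (x₂ 1) with ha
  let P₂' : (zdGraph 2).Walk a y₂ := Walk.cons (mono_adj_leftOf hx₂'.2) P₂
  -- the lower path, extended: from `e = (-1,-1)` up the column `x = -1` to `(-1,(x₁)₁)`, right to `x₁`, then `W` to `t`
  set z : Site 2 := pt (-1) (x₁ 1) with hz
  set k : ℕ := (x₁ 1 + 1).toNat with hk
  have hkz : (k : ℤ) = x₁ 1 + 1 := by rw [hk, Int.toNat_of_nonneg (by omega)]
  let D := downRun z k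
  let Q' : (zdGraph 2).Walk _ t := (D.reverse.append (Walk.cons (mono_adj_leftOf hx₁'.2) Walk.nil)).append W
  have hQsupp : ∀ w ∈ Q'.support, w ∈ D.support ∨ w ∈ W.support := by
    intro w hw
    rcases (Walk.mem_support_append_iff _ _).1 hw with hw | hw
    · rcases (Walk.mem_support_append_iff _ _).1 hw with hw | hw
      · left; rwa [Walk.support_reverse, List.mem_reverse] at hw
      · rw [Walk.support_cons, Walk.support_nil, List.mem_cons, List.mem_singleton] at hw
        rcases hw with rfl | rfl
        · exact Or.inl D.start_mem_support
        · exact Or.inr W.start_mem_support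
    · exact Or.inr hw
  -- coordinate bounds
  have hPb : ∀ w ∈ P₂'.support, (-1 : ℤ) ≤ w 0 ∧ w 0 ≤ (m : ℤ) ∧ (-1 : ℤ) ≤ w 1 ∧ w 1 ≤ (n : ℤ) := by
    intro w hw
    rw [Walk.support_cons, List.mem_cons] at hw
    rcases hw with rfl | hw
    · simp only [ha, pt, Matrix.cons_val_zero, Matrix.cons_val_one, Matrix.cons_val_fin_one]; omega
    · have := mem_rectangle_iff.1 (Finset.mem_coe.1 (hP₂S w hw)); omega
  have hQb : ∀ w ∈ Q'.support, (-1 : ℤ) ≤ w 0 ∧ w 0 ≤ (m : ℤ) ∧ (-1 : ℤ) ≤ w 1 ∧ w 1 ≤ (n : ℤ) := by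
    intro w hw
    rcases hQsupp w hw with hw | hw
    · have h := mem_support_downRun.1 hw
      simp only [hz, pt, Matrix.cons_val_zero, Matrix.cons_val_one, Matrix.cons_val_fin_one] at h
      omega
    · have := mem_rectangle_iff.1 (Finset.mem_coe.1 (hWS w hw)); omega
  have hstart : ((fun w : Site 2 => w - Pi.single 1 1)^[k] z) 1 = -1 := by
    rw [iterate_sub_single_apply_one]; simp only [hz, pt, Matrix.cons_val_one, Matrix.cons_val_fin_one]; omega
  obtain ⟨v, hvP, hvQ⟩ := exists_mem_support_of_crossing (L := -1) (R := m) (B := -1) (T := n) P₂' Q' hPb hQb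
    (by simp [ha, pt]) hy₂'.2 hstart ht
  -- the meeting vertex lies on `P₂` and on `W`
  rw [Walk.support_cons, List.mem_cons] at hvP
  rcases hvP with rfl | hvP
  · -- `v = a = (-1,(x₂)₁)` is not on `Q'`: the column part has heights `≤ (x₁)₁ < (x₂)₁`, the rest has `x ≥ 0`
    rcases hQsupp _ hvQ with hv | hv
    · have h := mem_support_downRun.1 hv
      simp only [ha, hz, pt, Matrix.cons_val_zero, Matrix.cons_val_one, Matrix.cons_val_fin_one] at h
      omega
    · have := mem_rectangle_iff.1 (Finset.mem_coe.1 (hWS _ hv))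
      simp only [ha, pt, Matrix.cons_val_zero] at this
      omega
  · rcases hQsupp v hvQ with hv | hv
    · -- on the column `x = -1`: impossible for a vertex of `P₂ ⊆ [0,m]×[0,n]`
      have h := mem_support_downRun.1 hv
      have := mem_rectangle_iff.1 (Finset.mem_coe.1 (hP₂S v hvP))
      simp only [hz, pt, Matrix.cons_val_zero, Matrix.cons_val_one, Matrix.cons_val_fin_one] at h
      omega
    · have c₁ : ω ∈ openConnIn (rectangle m n : Set (Site 2)) x₁ v := mem_openConnIn_of_mem_support W hWS hWω hv
      have c₂ : ω ∈ openConnIn (rectangle m n : Set (Site 2)) x₂ v := mem_openConnIn_of_mem_support P₂ hP₂S hP₂ω hvP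
      rw [openConnIn_comm] at c₂
      exact h₁₂ (PlanarDuality.openConnIn_trans c₁ c₂)

/-! ## §2 Monotonicity of the two-cluster event in the width -/

/-- One direction of the width-monotonicity on ordered endpoints: if `x₁` is strictly below `x₂` (both on the left
side, `x₂ ↔` right side, `x₁ ↮ x₂` in `[0,m]×[0,n]`), then `x₁ ↮ x₂` also in `[0,m]×[0,n+1]` — a joining path of the
taller rectangle, stopped at its first visit to the row `n` (`exists_openConnIn_le_level`), would join `x₁` to the top
row inside `[0,m]×[0,n]`. [folklore] -/
theorem mono_not_openConnIn_succ {m n : ℕ} {ω : BondConfig (Site 2)} (hω : ω ⊆ (zdGraph 2).edgeSet)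
    {x₁ x₂ y₂ : Site 2} (hx₁ : x₁ ∈ (leftSide m n : Set (Site 2))) (hx₂ : x₂ ∈ (leftSide m n : Set (Site 2)))
    (hlt : x₁ 1 < x₂ 1) (hy₂ : y₂ ∈ (rightSide m n : Set (Site 2)))
    (h₂ : ω ∈ openConnIn (rectangle m n : Set (Site 2)) x₂ y₂)
    (h₁₂ : ω ∉ openConnIn (rectangle m n : Set (Site 2)) x₁ x₂) :
    ω ∉ openConnIn (rectangle m (n + 1) : Set (Site 2)) x₁ x₂ := by
  classical
  intro hconn
  obtain ⟨W, hWS, hWω⟩ := exists_walk_of_mem_openConnIn hω hconn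
  have hx₂R := mem_rectangle_iff.1 (Finset.mem_filter.1 (Finset.mem_coe.1 hx₂)).1
  have hx₁R := mem_rectangle_iff.1 (Finset.mem_filter.1 (Finset.mem_coe.1 hx₁)).1
  by_cases htop : ∃ u ∈ W.support, u 1 = (n : ℤ) + 1
  · obtain ⟨u, hu, hu1⟩ := htop
    have hxu : ω ∈ openConnIn (rectangle m (n + 1) : Set (Site 2)) x₁ u := mem_openConnIn_of_mem_support W hWS hWω hu
    obtain ⟨t, ht, hxt⟩ := exists_openConnIn_le_level hω (fun w : Site 2 => w 1)
      (fun _ _ h => (zdGraph_adj_apply_le h 1).1) (n : ℤ) (by omega) (by omega) hxu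
    have hsub : (rectangle m (n + 1) : Set (Site 2)) ∩ {w | w 1 ≤ (n : ℤ)} ⊆ (rectangle m n : Set (Site 2)) := by
      rintro w ⟨hw, hw1⟩
      have := mem_rectangle_iff.1 (Finset.mem_coe.1 hw)
      simp only [Set.mem_setOf_eq] at hw1
      exact Finset.mem_coe.2 (mem_rectangle_iff.2 (by push_cast at this ⊢; omega))
    exact mono_not_openConnIn_topRow hω hx₁ hx₂ hlt hy₂ h₂ h₁₂ ht (openConnIn_mono hsub x₁ t hxt)
  · push Not at htop
    have hWR : ∀ w ∈ W.support, w ∈ (rectangle m n : Set (Site 2)) := by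
      intro w hw
      have := mem_rectangle_iff.1 (Finset.mem_coe.1 (hWS w hw))
      have hne := htop w hw
      exact Finset.mem_coe.2 (mem_rectangle_iff.2 (by push_cast at this ⊢; omega))
    exact h₁₂ (mem_openConnIn_of_walk W hWR hWω)

/-- **The two-cluster event is monotone in the width** (registered sub-goal `twoClusterEvent_mono_succ` of
stmt-CriticalPhenomena-13878, lead c5): on a lattice configuration, two open LR crossings of `[0,m]×[0,n]` in distinct
clusters of the rectangle are two open LR crossings of `[0,m]×[0,n+1]` in distinct clusters of the taller rectangle. [folklore] -/
theorem twoClusterEvent_mono_succ : ∀ (m n : ℕ) (ω : BondConfig (Site 2)), ω ⊆ (zdGraph 2).edgeSet → (∃ x₁ ∈ (leftSide m n : Set (Site 2)), ∃ y₁ ∈ (rightSide m n : Set (Site 2)), ∃ x₂ ∈ (leftSide m n : Set (Site 2)), ∃ y₂ ∈ (rightSide m n : Set (Site 2)), ω ∈ openConnIn (rectangle m n : Set (Site 2)) x₁ y₁ ∧ ω ∈ openConnIn (rectangle m n : Set (Site 2)) x₂ y₂ ∧ ω ∉ openConnIn (rectangle m n : Set (Site 2)) x₁ x₂) → ∃ x₁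 ∈ (leftSide m (n + 1) : Set (Site 2)), ∃ y₁ ∈ (rightSide m (n + 1) : Set (Site 2)), ∃ x₂ ∈ (leftSide m (n + 1) : Set (Site 2)), ∃ y₂ ∈ (rightSide m (n + 1) : Set (Site 2)), ω ∈ openConnIn (rectangle m (n + 1) : Set (Site 2)) x₁ y₁ ∧ ω ∈ openConnIn (rectangle m (n + 1) : Set (Site 2)) x₂ y₂ ∧ ω ∉ openConnIn (rectangle m (n + 1) : Set (Site 2)) x₁ x₂ := by
  intro m n ω hω h
  obtain ⟨x₁, hx₁, y₁, hy₁, x₂, hx₂, y₂, hy₂, h₁, h₂, h₁₂⟩ := h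
  have hR : (rectangle m n : Set (Site 2)) ⊆ (rectangle m (n + 1) : Set (Site 2)) := by
    intro w hw
    have := mem_rectangle_iff.1 (Finset.mem_coe.1 hw)
    exact Finset.mem_coe.2 (mem_rectangle_iff.2 (by push_cast; omega))
  have hL : (leftSide m n : Set (Site 2)) ⊆ (leftSide m (n + 1) : Set (Site 2)) := by
    intro w hw
    have h := Finset.mem_filter.1 (Finset.mem_coe.1 hw)
    exact Finset.mem_coe.2 (Finset.mem_filter.2 ⟨Finset.mem_coe.1 (hR (Finset.mem_coe.2 h.1)), h.2⟩)
  have hRS : (rightSide m n : Set (Site 2)) ⊆ (rightSide m (n + 1) : Set (Site 2)) := by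
    intro w hw
    have h := Finset.mem_filter.1 (Finset.mem_coe.1 hw)
    exact Finset.mem_coe.2 (Finset.mem_filter.2 ⟨Finset.mem_coe.1 (hR (Finset.mem_coe.2 h.1)), h.2⟩)
  refine ⟨x₁, hL hx₁, y₁, hRS hy₁, x₂, hL hx₂, y₂, hRS hy₂, openConnIn_mono hR x₁ y₁ h₁, openConnIn_mono hR x₂ y₂ h₂, ?_⟩
  -- order the two left endpoints
  have hx₁0 := (Finset.mem_filter.1 (Finset.mem_coe.1 hx₁)).2
  have hx₂0 := (Finset.mem_filter.1 (Finset.mem_coe.1 hx₂)).2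
  have hne : x₁ 1 ≠ x₂ 1 := by
    intro heq
    have hxx : x₁ = x₂ := by
      ext i; fin_cases i
      · exact hx₁0.trans hx₂0.symm
      · exact heq
    exact h₁₂ (hxx ▸ openConnIn_refl (Finset.mem_coe.2 (Finset.mem_filter.1 (Finset.mem_coe.1 hx₁)).1))
  rcases lt_or_gt_of_ne hne with hlt | hgt
  · exact mono_not_openConnIn_succ hω hx₁ hx₂ hlt hy₂ h₂ h₁₂
  · rw [openConnIn_comm] at h₁₂ ⊢
    exact mono_not_openConnIn_succ hω hx₂ hx₁ hgt hy₁ h₁ h₁₂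

/-! ## §3 Consequences: `p₂` is monotone and `γ₂` antitone in the width -/

/-- **`p₂(m,n) ≤ p₂(m,n+1)`**. [folklore] -/
theorem pTwo_le_succ (m n : ℕ) : pTwo m n ≤ pTwo m (n + 1) := by
  refine ENNReal.toReal_mono (measure_ne_top _ _) (measure_mono_ae ?_)
  filter_upwards [ae_subset_edgeSet (zdGraph 2) half] with ω hω h
  exact twoClusterEvent_mono_succ m n ω hω h

/-- **`p₂` is monotone in the width**: `p₂(m,n) ≤ p₂(m,n')` for `n ≤ n'`. [folklore] -/
theorem pTwo_mono_right (m : ℕ) {n n' : ℕ} (h : n ≤ n') : pTwo m n ≤ pTwo m n' := by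
  induction h with
  | refl => exact le_rfl
  | step _ ih => exact ih.trans (pTwo_le_succ m _)

/-- **The two-cluster rate is antitone in the width**: `γ₂(n') ≤ γ₂(n)` for `1 ≤ n ≤ n'` (rates as in the crux). [folklore] -/
theorem rateTwo_antitone {n n' : ℕ} (hn : 1 ≤ n) (hnn' : n ≤ n') {γ γ' : ℝ}
    (h : Tendsto (rateSeqTwo n) atTop (𝓝 γ)) (h' : Tendsto (rateSeqTwo n') atTop (𝓝 γ')) : γ' ≤ γ := by
  refine le_of_tendsto_of_tendsto h' h (Eventually.of_forall fun m ↦ ?_)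
  have hp : 0 < pTwo m n := lt_of_lt_of_le (by positivity) (pTwo_ge (m := m) hn)
  have := Real.log_le_log hp (pTwo_mono_right m hnn')
  exact div_le_div_of_nonneg_right (by linarith) (by positivity)

end Summit.CriticalPhenomena.CardyFormulaZ2.Cruxes.StripClusterRates.TwoClusterRateIsStationaryGap

end
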